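import Summits.QuantumFields.BalabanUV.Beta.FP.PerfectSymbol166RealLine

/-!
# `BalabanUV.Beta.FP.CoarseCovarianceStripW` — road «FP» (binder row D1), row H′2-IR ∕ IR-2 (ii) «STRIP STRUCTURE OF THE COARSE
# COVARIANCE SYMBOL», file (W): **the `2π`-PERIODIC holomorphic continuum weight `W_∞^{per}(μ,ν; p) := W_∞(μ,ν; wrap p)`** on the
# periodic strip `{p : |Im p_i| ≤ κ}` (all real parts) — continuous, holomorphic in every coordinate slice (across the seams
# `Re p_i ≡ π (mod 2π)`), bounded by `M₁₆₆(d)`, equal to `W_∞` on the Brillouin strip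

HONEST FRAMING (cell contract, verbatim): «discharging `BetaPertH` makes Bałaban's UV stability UNCONDITIONAL — a real constructive-QFT
result; it is NOT the continuum limit and NOT the Clay problem.»  HONEST DEPENDENCY (verbatim): «continuum YM on T⁴ ⇐ BetaPertH ∧ nine
spine estimates (0/9 proved); BetaPertH ⇐ (D1) ∧ (D4) ∧ CAP+tail; G-an2-4 gates asym, D1 and NE2/3/4.»  THIS MODULE DISCHARGES NOTHING of
D1 ∕ BetaPertH: [folklore] one-complex-variable bookkeeping (identity theorem, uniqueness of limits, pasting of continuous pieces) over the
road's OWN closed-form `k = ∞` multiplier `W166Inf` and tree theorems BY NAME (`B5Symbol166Strip.W166_tr`, `PerfectSymbol166.tendsto_W166`,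
`PerfectSymbol166StripReg.differentiableAt_W166Inf_slice_fatStripO` ∕ `norm_W166Inf_le_bound166`, `PerfectSymbol166HoloW.continuousOn_W166Inf_strip`,
the side-neighbourhood frame of `PerfectSymbol166RealLine`).  Three [our object] data defs (`wrapRe`, `wrapC`, `Wper`) and two set abbreviations
(`PStrip`, `shiftS`); no `def … : Prop`; nothing is cited; 0 sorry.  NOT summit progress; NOT BetaPertH, NOT continuum, NOT Clay.

ABSOLUTE RULE (cell, verbatim): «No internally-minted statement may enter as a cited fact. Every hypothesis is either kernel-proved in this
package or a verbatim quotation of a PUBLISHED theorem with page reference. The manuscript(s) under audit are NOT citable for their own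
disputed steps — they are the thing under adjudication; programme-internal (2001/route/tribunal) claims are never citable.»

WHY (owner design memo `HOME/b2b-balaban-beta-d1-p3/H2IR-DESIGN.md` §IR-2 (ii)–(iv); INTENT journal l.22234).  The alias sum of the coarse
covariance symbol `Ĉ_n(k) = n^{−(3D+2)} Σ_{l ∈ {0,…,n−1}^D} q̂(k_l) P̂(k_l) q̂(−k_l)`, `k_l = (k + 2πl)/n`, evaluates the perfect propagator
symbol at alias momenta whose REAL PARTS range over `[−π/n, 2π)` — outside the Brillouin strip `|Re| ≤ π` on which the tree controls `W_∞`.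
The strip analysis of (ii)∕(iv) therefore needs `W_∞` as ONE function on the periodic strip, holomorphic across the seams.  The tree proves
periodicity of `W_∞` only ACROSS THE SIDES with the other coordinates real (`W166Inf_sides`, `sliceW_add_two_pi`); here the other coordinates
are arbitrary points of the closed strip (needed for joint continuity and for Cauchy estimates in one coordinate at complex values of the others).

CONTENT.
* §1 `wrapRe z := ⟨toIocMod 2π (−π) (Re z), Im z⟩` (reduce the real part into `(−π, π]`), `wrapC` (coordinatewise), `PStrip d κ := {p | ∀ i, |Im p_i| ≤ κ}`;
  [folklore] algebra: `wrapRe_add_two_pi`, `wrapRe_sub_zsmul`, `wrapRe_eq_self`, `wrapRe_eq_sub_of_mem`, `wrapC_mem_strip`, `wrapC_update`.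
* §2 [our object] **`Wper μ ν p := W166Inf μ ν (wrapC p)`**: `Wper_periodic` (every complex `p`, every coordinate), `Wper_eq_of_mem` (= `W_∞` when all
  `Re p_i ∈ (−π, π]`), `Wper_zero = 1`, `norm_Wper_le` (`≤ bound166 d` on `PStrip d (κ₁₆₆ d)`), `norm_Wper_le_MW`.
* §3 [folklore] **SIDE MATCHING WITH COMPLEX OTHER COORDINATES** `W166Inf_tr`: for `p ∈ Strip d κ` (`κ ≤ κ₁₆₆`), `Re p_i = −π`, `μ ≠ ν`:
  `W_∞(p + 2πe_i) = W_∞(p)` (both sides are limits of `W166 (j+1)`, equal termwise by `B5Symbol166Strip.W166_tr`); `W166Inf_shiftS` (several coordinates).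
* §4 [folklore] **PERIODICITY NEAR THE SEAM, COMPLEX OTHER COORDINATES** `W166Inf_update_add_two_pi`: for `q ∈ Strip d (κ₁₆₆ d)` and `w` in the side
  neighbourhood, `W_∞(update q i (w + 2π)) = W_∞(update q i w)` (identity theorem on the side neighbourhood, zeros from §3 — the pattern of
  `PerfectSymbol166RealLine.sliceW_add_two_pi`).
* CONTINUITY on the periodic strip and SLICE HOLOMORPHY across the seams: the sequel `FP/CoarseCovarianceStripWReg` (§5–§6 of the INTENT).
Unit `b2b-balaban-beta-d1-formalise-leaf-06` (gen 7), road FP row H′2-IR ∕ IR-2 (ii), owner ruling R-FP-21 (A3)∕(C).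
-/

noncomputable section

namespace Summit.QuantumFields.BalabanUV.Beta.FP.CoarseCovarianceStripW

open Filter Topology Finset Complex Set Metric
open scoped BigOperators
open Literature.MathematicalPhysics.QuantumFieldTheory.Balaban1983to89
open B4Strip (Strip ofRealVec)
open B5Symbol166 (W166)
open B5Symbol166Strip (kappa166 kappa166_pos MW W166_tr)
open Summit.QuantumFields.BalabanUV.Beta.FP.PerfectSymbol166 (W166Inf W166Inf_zero tendsto_W166)
open Summit.QuantumFields.BalabanUV.Beta.FP.PerfectSymbol166HoloW (continuousOn_W166Inf_strip)
open Summit.QuantumFields.BalabanUV.Beta.FP.PerfectSymbol166StripReg (FatStrip FatStripO delta166 delta166_pos bound166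
  norm_W166Inf_le_bound166 strip_subset_fatStrip differentiableAt_W166Inf_slice_fatStripO norm_W166Inf_le_strip)
open Summit.QuantumFields.BalabanUV.Beta.FP.PerfectSymbol166RealLine (sideNbhd isOpen_sideNbhd isPreconnected_sideNbhd
  sideNbhd_mem delta166_le_pi fatRectO)

variable {d : ℕ}

/-! ## §1 Wrapping the real part into `(−π, π]` -/

/-- [our object] the periodic closed strip `{p | ∀ i, |Im p_i| ≤ κ}` (all real parts). -/
def PStrip (d : ℕ) (κ : ℝ) : Set (Fin d → ℂ) := {p | ∀ i, |(p i).im| ≤ κ}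

/-- [our object] reduce the real part of `z` into `(−π, π]`, keep the imaginary part. -/
def wrapRe (z : ℂ) : ℂ := ⟨toIocMod Real.two_pi_pos (-Real.pi) z.re, z.im⟩

/-- [folklore] real part of the wrap. -/
theorem wrapRe_re (z : ℂ) : (wrapRe z).re = toIocMod Real.two_pi_pos (-Real.pi) z.re := rfl

/-- [folklore] the wrap keeps the imaginary part. -/
theorem wrapRe_im (z : ℂ) : (wrapRe z).im = z.im := rfl

/-- [folklore] the wrapped real part lies in `(−π, π]`. -/
theorem wrapRe_re_mem (z : ℂ) : (wrapRe z).re ∈ Set.Ioc (-Real.pi) Real.pi := by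
  have h := toIocMod_mem_Ioc Real.two_pi_pos (-Real.pi) z.re
  have e : -Real.pi + 2 * Real.pi = Real.pi := by ring
  rw [e] at h
  exact h

/-- [folklore] `|Re (wrapRe z)| ≤ π`. -/
theorem abs_wrapRe_re_le (z : ℂ) : |(wrapRe z).re| ≤ Real.pi :=
  abs_le.mpr ⟨(wrapRe_re_mem z).1.le, (wrapRe_re_mem z).2⟩

/-- [folklore] the wrap is the identity when `Re z ∈ (−π, π]`. -/
theorem wrapRe_eq_self {z : ℂ} (hz : z.re ∈ Set.Ioc (-Real.pi) Real.pi) : wrapRe z = z := by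
  apply Complex.ext
  · rw [wrapRe_re, toIocMod_eq_self]
    have e : -Real.pi + 2 * Real.pi = Real.pi := by ring
    rw [e]; exact hz
  · rfl

/-- [folklore] the wrap is `2π`-periodic. -/
theorem wrapRe_add_two_pi (z : ℂ) : wrapRe (z + 2 * Real.pi) = wrapRe z := by
  apply Complex.ext
  · have e : (z + 2 * (Real.pi : ℂ)).re = z.re + 2 * Real.pi := by simp
    rw [wrapRe_re, wrapRe_re, e, toIocMod_add_right]
  · simp [wrapRe_im]

/-- [folklore] the wrap is invariant under integer multiples of `2π`. -/
theorem wrapRe_sub_zsmul (z : ℂ) (m : ℤ) : wrapRe (z - (m : ℂ) * (2 * Real.pi)) = wrapRe z := by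
  apply Complex.ext
  · have e : (z - (m : ℂ) * (2 * (Real.pi : ℂ))).re = z.re - m • (2 * Real.pi) := by simp [zsmul_eq_mul]
    rw [wrapRe_re, wrapRe_re, e, toIocMod_sub_zsmul]
  · simp [wrapRe_im]

/-- [folklore] just above the seam the wrap subtracts `2π`: `Re z ∈ (π, 3π] ⟹ wrapRe z = z − 2π`. -/
theorem wrapRe_eq_sub_of_mem {z : ℂ} (hz : z.re ∈ Set.Ioc Real.pi (3 * Real.pi)) : wrapRe z = z - 2 * Real.pi := by
  have h : wrapRe (z - 2 * Real.pi + 2 * Real.pi) = wrapRe (z - 2 * Real.pi) := wrapRe_add_two_pi _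
  rw [sub_add_cancel] at h
  rw [h, wrapRe_eq_self]
  have e : (z - 2 * (Real.pi : ℂ)).re = z.re - 2 * Real.pi := by simp
  rw [e]
  exact ⟨by linarith [hz.1], by linarith [hz.2]⟩

/-- [our object] coordinatewise wrap. -/
def wrapC (p : Fin d → ℂ) : Fin d → ℂ := fun i => wrapRe (p i)

/-- [folklore] unfolding. -/
theorem wrapC_apply (p : Fin d → ℂ) (i : Fin d) : wrapC p i = wrapRe (p i) := rfl

/-- [folklore] the wrap of a point of the periodic strip lies in the Brillouin strip. -/
theorem wrapC_mem_strip {κ : ℝ} {p : Fin d → ℂ} (hp : p ∈ PStrip d κ) : wrapC p ∈ Strip d κ :=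
  fun i => ⟨abs_wrapRe_re_le _, by rw [wrapC_apply, wrapRe_im]; exact hp i⟩

/-- [folklore] wrapping commutes with updating one coordinate. -/
theorem wrapC_update (p : Fin d → ℂ) (i : Fin d) (z : ℂ) :
    wrapC (Function.update p i z) = Function.update (wrapC p) i (wrapRe z) := by
  funext j
  by_cases h : j = i
  · subst h; simp [wrapC]
  · simp [wrapC, h]

/-- [folklore] the wrap is the identity on the cell `(−π, π]^d × iℝ^d`. -/
theorem wrapC_eq_self {p : Fin d → ℂ} (hp : ∀ i, (p i).re ∈ Set.Ioc (-Real.pi) Real.pi) : wrapC p = p :=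
  funext fun i => wrapRe_eq_self (hp i)

/-! ## §2 The periodic weight -/

/-- [our object] **THE `2π`-PERIODIC CONTINUUM WEIGHT** `W_∞^{per}(μ,ν; p) := W_∞(μ,ν; wrapC p)`. -/
def Wper (μ ν : Fin d) (p : Fin d → ℂ) : ℂ := W166Inf μ ν (wrapC p)

/-- [our object] on the cell `Re p_i ∈ (−π, π]` the periodic weight IS `W_∞`. -/
theorem Wper_eq_of_mem (μ ν : Fin d) {p : Fin d → ℂ} (hp : ∀ i, (p i).re ∈ Set.Ioc (-Real.pi) Real.pi) :
    Wper μ ν p = W166Inf μ ν p := by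
  rw [Wper, wrapC_eq_self hp]

/-- [our object] **PERIODICITY**, every complex point, every coordinate: `W^{per}(update p i (p i + 2π)) = W^{per}(p)`. -/
theorem Wper_periodic (μ ν : Fin d) (p : Fin d → ℂ) (i : Fin d) :
    Wper μ ν (Function.update p i (p i + 2 * Real.pi)) = Wper μ ν p := by
  unfold Wper
  rw [wrapC_update, wrapRe_add_two_pi, ← wrapC_apply p i, Function.update_eq_self]

/-- [our object] invariance under a lattice translate `p ↦ p − 2πm`, `m ∈ ℤ^d`. -/
theorem Wper_sub_zsmul (μ ν : Fin d) (p : Fin d → ℂ) (m : Fin d → ℤ) :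
    Wper μ ν (fun i => p i - (m i : ℂ) * (2 * Real.pi)) = Wper μ ν p := by
  unfold Wper
  congr 1
  funext i
  simp only [wrapC_apply, wrapRe_sub_zsmul]

/-- [our object] `W^{per}(0) = 1`. -/
theorem Wper_zero (μ ν : Fin d) : Wper μ ν (0 : Fin d → ℂ) = 1 := by
  have h : wrapC (0 : Fin d → ℂ) = 0 :=
    wrapC_eq_self fun i => by simpa using ⟨by linarith [Real.pi_pos], Real.pi_pos.le⟩
  rw [Wper, h, W166Inf_zero]

/-- [our object] **BOUND** `‖W^{per}(μ,ν;p)‖ ≤ M₁₆₆(d)` on the periodic strip of width `κ₁₆₆(d)`. -/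
theorem norm_Wper_le (μ ν : Fin d) {p : Fin d → ℂ} (hp : p ∈ PStrip d (kappa166 d)) : ‖Wper μ ν p‖ ≤ bound166 d :=
  norm_W166Inf_le_bound166 μ ν (strip_subset_fatStrip (delta166_pos d).le (wrapC_mem_strip hp))

/-- [our object] the bound `MW d` on a periodic strip of width `κ ≤ κ₁₆₆(d)`. -/
theorem norm_Wper_le_MW {κ : ℝ} (hκ0 : 0 ≤ κ) (hκ : κ ≤ kappa166 d) (μ ν : Fin d) {p : Fin d → ℂ} (hp : p ∈ PStrip d κ) :
    ‖Wper μ ν p‖ ≤ MW d :=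
  norm_W166Inf_le_strip hκ0 hκ (wrapC_mem_strip hp) μ ν

/-! ## §3 Side matching with complex other coordinates -/

/-- [folklore] **`W_∞(p + 2πe_i) = W_∞(p)` ON THE LEFT SIDE, OTHER COORDINATES ANYWHERE IN THE CLOSED STRIP**: both sides are limits of
`W166 (j+1)` (`tendsto_W166`), equal for every `j` by `B5Symbol166Strip.W166_tr`. -/
theorem W166Inf_tr {κ : ℝ} (hκ0 : 0 ≤ κ) (hκ : κ ≤ kappa166 d) {p : Fin d → ℂ} (hp : p ∈ Strip d κ) (i : Fin d)
    (hre : (p i).re = -Real.pi) {μ ν : Fin d} (hμν : μ ≠ ν) :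
    W166Inf μ ν (Function.update p i (p i + 2 * Real.pi)) = W166Inf μ ν p := by
  have hpt : Function.update p i (p i + 2 * Real.pi) ∈ Strip d κ := by
    intro j
    by_cases h : j = i
    · subst h
      simp only [Function.update_self]
      refine ⟨?_, ?_⟩
      · have e : (p j + 2 * (Real.pi : ℂ)).re = Real.pi := by simp [hre]; ring
        rw [e, abs_of_pos Real.pi_pos]
      · have e : (p j + 2 * (Real.pi : ℂ)).im = (p j).im := by simp
        rw [e]; exact (hp j).2
    · rw [Function.update_of_ne h]; exact hp j
  have h1 := tendsto_W166 hκ0 hκ hpt μ ν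
  have h2 := tendsto_W166 hκ0 hκ hp μ ν
  have e : (fun j : ℕ => W166 (j + 1) μ ν (Function.update p i (p i + 2 * Real.pi))) = fun j => W166 (j + 1) μ ν p := by
    funext j
    exact W166_tr (j + 1) hκ0 hκ hp i hre hμν
  rw [e] at h1
  exact tendsto_nhds_unique h1 h2

/-- [our object] shift down by `2π` on the coordinates of `S`. -/
def shiftS (S : Finset (Fin d)) (q : Fin d → ℂ) : Fin d → ℂ := fun i => if i ∈ S then q i - 2 * Real.pi else q i

/-- [folklore] **SEVERAL COORDINATES ON THE RIGHT SIDE**: if `q ∈ Strip d κ` and `Re q_i = π` for all `i ∈ S`, then `W_∞(shiftS S q) = W_∞(q)`. -/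
theorem W166Inf_shiftS {κ : ℝ} (hκ0 : 0 ≤ κ) (hκ : κ ≤ kappa166 d) {μ ν : Fin d} (hμν : μ ≠ ν) (S : Finset (Fin d)) :
    ∀ q ∈ Strip d κ, (∀ i ∈ S, (q i).re = Real.pi) → W166Inf μ ν (shiftS S q) = W166Inf μ ν q := by
  induction S using Finset.induction_on with
  | empty =>
    intro q _ _
    have e : shiftS (∅ : Finset (Fin d)) q = q := funext fun i => by simp [shiftS]
    rw [e]
  | @insert i S hi ih =>
    intro q hq hre
    have hS : ∀ j ∈ S, (q j).re = Real.pi := fun j hj => hre j (Finset.mem_insert_of_mem hj)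
    have e : Function.update (shiftS (insert i S) q) i (shiftS (insert i S) q i + 2 * Real.pi) = shiftS S q := by
      funext j
      by_cases hj : j = i
      · subst hj; simp [shiftS, hi]
      · rw [Function.update_of_ne hj]
        simp [shiftS, hj]
    have hr : shiftS (insert i S) q ∈ Strip d κ := by
      intro j
      by_cases hj : j ∈ insert i S
      · simp only [shiftS, hj, if_true]
        refine ⟨?_, ?_⟩
        · have e2 : (q j - 2 * (Real.pi : ℂ)).re = -Real.pi := by simp [hre j hj]; ring
          rw [e2, abs_neg, abs_of_pos Real.pi_pos]
        · have e2 : (q j - 2 * (Real.pi : ℂ)).im = (q j).im := by simp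
          rw [e2]; exact (hq j).2
      · simp only [shiftS, hj, if_false]; exact hq j
    have hrei : (shiftS (insert i S) q i).re = -Real.pi := by
      simp [shiftS, hre i (Finset.mem_insert_self i S)]; ring
    have h := W166Inf_tr hκ0 hκ hr i hrei hμν
    rw [e] at h
    rw [← ih q hq hS]
    exact h.symm

/-! ## §4 Periodicity near the seam, complex other coordinates (identity theorem) -/

/-- [folklore] a point of the closed strip with one coordinate replaced by a point of the open fat rectangle lies in the open fat strip. -/
theorem update_mem_fatStripO {q : Fin d → ℂ} (hq : q ∈ Strip d (kappa166 d)) (i : Fin d) {z : ℂ}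
    (hz : z ∈ fatRectO (kappa166 d) (delta166 d)) : Function.update q i z ∈ FatStripO d (kappa166 d) (delta166 d) := by
  intro j
  by_cases hj : j = i
  · subst hj; simp only [Function.update_self]; exact ⟨hz.1, hz.2⟩
  · rw [Function.update_of_ne hj]
    have h := hq j
    exact ⟨by linarith [h.1, delta166_pos d], by linarith [h.2, delta166_pos d]⟩

/-- [folklore] slice holomorphy of `W_∞` at points of the open fat rectangle, other coordinates in the closed strip. -/
theorem differentiableAt_W166Inf_update {μ ν : Fin d} {q : Fin d → ℂ} (hq : q ∈ Strip d (kappa166 d)) (i : Fin d) {z : ℂ}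
    (hz : z ∈ fatRectO (kappa166 d) (delta166 d)) :
    DifferentiableAt ℂ (fun w : ℂ => W166Inf μ ν (Function.update q i w)) z := by
  have h := differentiableAt_W166Inf_slice_fatStripO (update_mem_fatStripO hq i hz) i μ ν
  simp only [Function.update_idem, Function.update_self] at h
  exact h

/-- [folklore] **`W_∞(update q i (w + 2π)) = W_∞(update q i w)` FOR `w` IN THE SIDE NEIGHBOURHOOD**, `q ∈ Strip d (κ₁₆₆ d)`, `μ ≠ ν`: the difference is
holomorphic on the (connected) side neighbourhood and vanishes on the segment `{−π + iy : |y| ≤ κ₁₆₆}` (§3), which accumulates at `−π`. -/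
theorem W166Inf_update_add_two_pi {μ ν : Fin d} (hμν : μ ≠ ν) {q : Fin d → ℂ} (hq : q ∈ Strip d (kappa166 d)) (i : Fin d)
    {w : ℂ} (hw : w ∈ sideNbhd (kappa166 d) (delta166 d)) :
    W166Inf μ ν (Function.update q i (w + 2 * Real.pi)) = W166Inf μ ν (Function.update q i w) := by
  set U := sideNbhd (kappa166 d) (delta166 d) with hU
  set g : ℂ → ℂ := fun z => W166Inf μ ν (Function.update q i z) with hg
  set h : ℂ → ℂ := fun z => g (z + 2 * Real.pi) - g z with hh
  have hδπ := delta166_le_pi d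
  have hdiff : DifferentiableOn ℂ h U := by
    intro z hz
    obtain ⟨hz1, hz2⟩ := sideNbhd_mem hz hδπ
    have d1 : DifferentiableAt ℂ g (z + 2 * Real.pi) := differentiableAt_W166Inf_update hq i hz2
    have d2 : DifferentiableAt ℂ g z := differentiableAt_W166Inf_update hq i hz1
    exact ((d1.comp z (differentiableAt_id.add_const _)).sub d2).differentiableWithinAt
  have han : AnalyticOnNhd ℂ h U := (Complex.analyticOnNhd_iff_differentiableOn (isOpen_sideNbhd _ _)).mpr hdiff
  have hκ := kappa166_pos d
  have hδ := delta166_pos d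
  have h0U : (-(Real.pi : ℂ)) ∈ U := by
    refine ⟨?_, ?_, ?_⟩
    · simp only [Complex.neg_re, Complex.ofReal_re]; linarith
    · simp only [Complex.neg_re, Complex.ofReal_re]; linarith
    · simp only [Complex.neg_im, Complex.ofReal_im, neg_zero, abs_zero]; linarith
  have hzero : ∀ y : ℝ, |y| ≤ kappa166 d → h (-Real.pi + y * I) = 0 := by
    intro y hy
    have hmem : Function.update q i (-Real.pi + y * I) ∈ Strip d (kappa166 d) := by
      intro j
      by_cases hj : j = i
      · subst hj
        simp only [Function.update_self]
        refine ⟨?_, ?_⟩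
        · have e : (-(Real.pi : ℂ) + y * I).re = -Real.pi := by simp
          rw [e, abs_neg, abs_of_pos Real.pi_pos]
        · have e : (-(Real.pi : ℂ) + y * I).im = y := by simp
          rw [e]; exact hy
      · rw [Function.update_of_ne hj]; exact hq j
    have hre : (Function.update q i (-Real.pi + y * I) i).re = -Real.pi := by simp
    have hs := W166Inf_tr (kappa166_pos d).le le_rfl hmem i hre hμν
    simp only [Function.update_idem, Function.update_self] at hs
    simp only [hh, hg]
    rw [hs, sub_self]
  have hfreq : ∃ᶠ z in 𝓝[≠] (-(Real.pi : ℂ)), h z = 0 := by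
    rw [Filter.frequently_iff]
    intro V hV
    obtain ⟨ε, hε, hVsub⟩ := Metric.mem_nhdsWithin_iff.mp hV
    set y : ℝ := min (ε / 2) (kappa166 d) with hy
    have hy0 : 0 < y := lt_min (by linarith) hκ
    have hyε : y < ε := by have := min_le_left (ε / 2) (kappa166 d); linarith
    have hyκ : |y| ≤ kappa166 d := by rw [abs_of_pos hy0]; exact min_le_right _ _
    refine ⟨-Real.pi + y * I, hVsub ⟨?_, ?_⟩, hzero y hyκ⟩
    · rw [mem_ball, Complex.dist_eq]
      have e : (-(Real.pi : ℂ) + y * I) - -(Real.pi : ℂ) = y * I := by ring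
      rw [e, norm_mul, Complex.norm_I, mul_one, Complex.norm_real, Real.norm_eq_abs, abs_of_pos hy0]
      exact hyε
    · intro heq
      have h1 := congrArg Complex.im heq
      simp only [Complex.add_im, Complex.neg_im, Complex.ofReal_im, neg_zero, Complex.mul_im, Complex.ofReal_re, Complex.I_im,
        mul_one, Complex.I_re, mul_zero, add_zero, zero_add] at h1
      exact hy0.ne' h1
  have hEq := han.eqOn_zero_of_preconnected_of_frequently_eq_zero (isPreconnected_sideNbhd _ _) h0U hfreq
  have hw' := hEq hw
  simp only [hh, hg, Pi.zero_apply, sub_eq_zero] at hw'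
  exact hw'

end Summit.QuantumFields.BalabanUV.Beta.FP.CoarseCovarianceStripW

end
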